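import Summits.ResolutionOfSingularities.ResolutionOfSingularities.Theorems.FrobeniusClosingPatchingRelPerfectDepthWeightTwoBPieceStepOut
import Summits.ResolutionOfSingularities.ResolutionOfSingularities.Theorems.FrobeniusClosingPatchingRelPerfectDepthWeightTwoBPieceStep
import Summits.ResolutionOfSingularities.ResolutionOfSingularities.Theorems.FrobeniusClosingPatchingRelPerfectDepthMixedTargetsJR
import Literature.AlgebraicGeometry.Resolution.CartierDivisorControlledTransformReduced
import Literature.AlgebraicGeometry.Resolution.BlowupDisjointCentreSplitting
import Literature.AlgebraicGeometry.Resolution.StrictTransformClosedSetPieces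
import Literature.AlgebraicGeometry.Resolution.KollarTripleBlowup
import HarnessLib

/-!
# Crux `PatchingRelPerfect` (stmt-ResolutionOfSingularities-16161), chain W5.2 — TargetsF5J/JR T5-E «W₂B-maxweight»:
# the PIECES LOOP — one Cossart–Jannsen–Saito centre, blown up connected component by connected component

[OURS · L1 W5.2 · TargetsF5J = JR, T5-E] Fact-free; NOT statements of the manuscript under review. SPEC = res-D-pv-054 AS
res-L1-w52-stub-6's `D/res-D-pv-054/WeightTwoBLoopSpec.lean` (2026-08-27), statement VERBATIM (`WeightTwoB.pieces_loop`).

A Cossart–Jannsen–Saito centre `V(C)` (regular) may be disconnected; its connected components `Zs` (a piece partition,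
`IsPiecePartition C Zs`) carry DIFFERENT maximal weights, so the E-side transport blows them up ONE AT A TIME
(Bierstone–Grigoriev–Milman–Włodarczyk 2011, §4 Step 2b; Stacks 080A read backwards: res-type-002's
`IsBlowup.exists_comp_eq_of_isPiecePartition_cons`, peeling `τ = τ₂ ≫ τ₁` with `τ₁` the blowing up of the first piece and `τ₂` a
blowing up of the regular centre formed by the lifted remaining pieces). Each single piece is one `IsWeightedSeqJR.cons` step:
the input clauses are res-D-pv-054's `WeightTwoB.PieceIn.*` (…DepthWeightTwoBPieceStep), the new transport state and the centre
data of the lifted remaining pieces are res-D-pv-054's `stateIn'` / `CentreIn.transport` (…DepthWeightTwoBPieceStepOut), the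
reducedness of the carried host is res-type-049's `IsBlowup.radical_controlledTransform_eq` ((L-D)), and the identification of
the two-step strict transform of the host support with the one-step one is res-type-049's
`IsBlowup.closure_preimage_closure_preimage_diff` ((L-G)).

* `pieces_loop_single` — ONE piece: the `cons` step with its witnesses `(ν, m, e, e')` exposed;
* `pieces_loop` — THE SPEC: induction on the number of pieces.

AI-written; AI review is weaker than expert review.

## References
* E. Bierstone, D. Grigoriev, P. Milman, J. Włodarczyk, arXiv:1206.3090, §4 Step 2b, Def. 3.1.3, §3.2 Lemma 3.2.1.
  [BierstoneGrigorievMilmanWlodarczyk2011]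
* V. Cossart, U. Jannsen, S. Saito, LNM 2270 (2020), Thm. 1.4, Def. 4.1, (6.2). [CossartJannsenSaito2020]
* The Stacks Project, Tags 080A, 02OS. [StacksProject]
* J. Kollár, *Lectures on Resolution of Singularities* (2007), 3.30.2. [Kollar2007]
-/

-- `Summit.<Summit>.<Sub>.Theorems` with `Sub = Summit` (single-conjunct summit, D-0017)
set_option linter.dupNamespace false

noncomputable section

open CategoryTheory CategoryTheory.Limits AlgebraicGeometry TopologicalSpace IsLocalRing
open Literature.AlgebraicGeometry.Resolution Scheme.IdealSheafData

namespace Summit.ResolutionOfSingularities.ResolutionOfSingularities.Theorems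

universe u

namespace WeightTwoB

open DepthTargets

/-! ## One piece -/

/-- **The single-piece step, packaged**: blowing up ONE piece `Z` (irreducible regular centre piece with its `CentreIn` data) of
the current transport state extends the weighted sequence with boundary by one `IsWeightedSeqJR.cons` step — weight
`ν = pieceWeight 𝔟 Z`, host order `m = ord_η D`, new lists `stepExp` — and yields the new transport state, the reducedness and the
support of the carried host, and the boundary bound. The witnesses `m, e, e'` are exposed so that the centre data of further
(disjoint) pieces can be transported with res-D-pv-054's `CentreIn.transport`.
[cite: BierstoneGrigorievMilmanWlodarczyk2011, §4 Step 2b, §3.2 Lemma 3.2.1] [cite: Kollar2007, 3.30.2] -/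
theorem pieces_loop_single
    {E W : Scheme.{u}} [IsIntegral W] [IsNoetherian W] {ρ : W ⟶ E} {𝔟₀ : E.IdealSheafData}
    {𝔟 D : W.IdealSheafData} {ℬ 𝒟 : List (W.IdealSheafData × ℕ)} (S : StateIn 𝔟 D ℬ 𝒟)
    (hseq : IsWeightedSeqJR 2 ρ 𝔟₀ 𝔟₀ [] [] 𝔟 D ℬ 𝒟)
    {Z : Closeds W} (Γ : CentreIn D ℬ Z)
    {B₀ : Set W} (hℬB : ∀ p ∈ ℬ, (p.1.support : Set W) ⊆ B₀) (hZB : (Z : Set W) ⊆ B₀)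
    {W' : Scheme.{u}} {τ : W' ⟶ W} (hτ : IsBlowup τ (vanishingIdeal Z)) :
    ∃ (_ : IsIntegral W') (_ : IsNoetherian W') (m e e' : ℕ),
      IsWeightedSeqJR 2 (τ ≫ ρ) 𝔟₀ 𝔟₀ [] []
          (controlledTransform τ (vanishingIdeal Z) 𝔟 (pieceWeight 𝔟 (Z : Set W)))
          (controlledTransform τ (vanishingIdeal Z) D m)
          (stepExp ℬ τ (vanishingIdeal Z) e) (stepExp 𝒟 τ (vanishingIdeal Z) e') ∧
        StateIn (controlledTransform τ (vanishingIdeal Z) 𝔟 (pieceWeight 𝔟 (Z : Set W)))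
          (controlledTransform τ (vanishingIdeal Z) D m)
          (stepExp ℬ τ (vanishingIdeal Z) e) (stepExp 𝒟 τ (vanishingIdeal Z) e') ∧
        controlledTransform τ (vanishingIdeal Z) D m =
          vanishingIdeal (controlledTransform τ (vanishingIdeal Z) D m).support ∧
        (((controlledTransform τ (vanishingIdeal Z) D m).support : Set W') =
          closure (τ ⁻¹' ((D.support : Set W) \ (Z : Set W)))) ∧
        (∀ p ∈ stepExp ℬ τ (vanishingIdeal Z) e, (p.1.support : Set W') ⊆ τ ⁻¹' B₀) := by
  obtain ⟨η, hη⟩ := Γ.exists_isGenericPoint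
  have P : PieceIn 𝔟 D ℬ 𝒟 Z η := S.pieceIn Γ hη
  obtain ⟨m, hm, hm1⟩ := P.exists_idealOrder_host_eq
  -- the centre is not the zero ideal: `Z ⊆ Supp D`, a proper closed subset
  have hCne : vanishingIdeal Z ≠ ⊥ := by
    intro h0
    have hZ : (Z : Set W) = Set.univ := by
      rw [← Scheme.IdealSheafData.coe_support_vanishingIdeal Z, h0, Scheme.IdealSheafData.support_bot]; rfl
    have hdense := S.hostCartier.dense_compl_support
    have hempty : ((D.support : Set W)ᶜ) = ∅ := by
      rw [Set.compl_empty_iff, Set.eq_univ_iff_forall]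
      intro x
      exact Γ.subZ (by rw [hZ]; trivial)
    have := hdense.nonempty
    rw [hempty] at this
    exact Set.not_nonempty_empty this
  haveI hint' : IsIntegral W' := hτ.isIntegral hCne
  haveI hnoeth' : IsNoetherian W' := isNoetherian_of_isBlowup hτ
  -- reducedness of the carried host ((L-D))
  have hDrad : D.radical = D := by
    conv_rhs => rw [S.hostRad]
    rw [Scheme.IdealSheafData.vanishingIdeal_support]
  have hrad' : (controlledTransform τ (vanishingIdeal Z) D m).radical = controlledTransform τ (vanishingIdeal Z) D m :=
    hτ.radical_controlledTransform_eq S.regW Γ.regZ P.gen' (P.subZ P.η_mem) hm S.hostCartier hDrad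
  have hrad : controlledTransform τ (vanishingIdeal Z) D m =
      vanishingIdeal (controlledTransform τ (vanishingIdeal Z) D m).support := by
    rw [Scheme.IdealSheafData.vanishingIdeal_support, hrad']
  set ν := pieceWeight 𝔟 (Z : Set W) with hν
  set w := weightOf ℬ (divisorsOver ℬ (vanishingIdeal Z) (vanishingIdeal Z).support) with hw
  set w𝒟 := weightOf 𝒟 (divisorsOver 𝒟 (vanishingIdeal Z) (vanishingIdeal Z).support) with hw𝒟
  refine ⟨hint', hnoeth', m, m + w - ν, w𝒟 + (2 - ν), ?_, ?_, hrad, support_host' S Γ hη hτ hm, ?_⟩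
  · -- the `cons` step
    have hZsupp : ∀ {z : W}, z ∈ (vanishingIdeal Z).support → z ∈ (Z : Set W) := fun {z} hz => by
      rwa [← Scheme.IdealSheafData.coe_support_vanishingIdeal Z]
    exact IsWeightedSeqJR.cons τ ρ 𝔟₀ 𝔟₀ [] [] 𝔟 D ℬ 𝒟 (vanishingIdeal Z) ν m hseq Γ.regZ P.isPreconnected
      (one_le_pieceWeight 𝔟 _) (pieceWeight_le_two 𝔟 _) P.le_pow_weight (P.host_le_pow hm) (P.weight_le_add hm hm1) Γ.sncZ
      P.uniformPieces.1 P.uniformPieces.2 (fun z hz hreq => P.joint_clause (hZsupp hz) hreq)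
      (fun hlt z hz => P.maxWeight_clause hlt (hZsupp hz)) hτ (not_host'_le_strict S Γ hτ) (not_host'_le_exc S Γ hη hτ hm)
  · -- the new state
    exact stateIn' S Γ hη hτ hm hrad
  · -- the boundary bound
    intro p hp
    rcases mem_stepExp_iff.mp hp with ⟨q, hq, rfl⟩ | rfl
    · intro x' hx'
      exact hℬB q hq (mem_support_of_mem_support_strictTransformIdeal hx')
    · intro x' hx'
      rw [Scheme.IdealSheafData.support_comap, Closeds.coe_preimage, Scheme.IdealSheafData.coe_support_vanishingIdeal] at hx'
      exact hZB hx'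

/-! ## The loop -/

/-- The induction behind `pieces_loop`, on the number of pieces. [cite: BierstoneGrigorievMilmanWlodarczyk2011, §4 Step 2b] -/
private theorem pieces_loop_aux {E : Scheme.{u}} {𝔟₀ : E.IdealSheafData} (n : ℕ) :
    ∀ {W : Scheme.{u}} [IsIntegral W] [IsNoetherian W] {ρ : W ⟶ E}
      {𝔟 D : W.IdealSheafData} {ℬ 𝒟 : List (W.IdealSheafData × ℕ)} (_S : StateIn 𝔟 D ℬ 𝒟)
      (_hseq : IsWeightedSeqJR 2 ρ 𝔟₀ 𝔟₀ [] [] 𝔟 D ℬ 𝒟)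
      {C : W.IdealSheafData} (_hC : Scheme.IsRegular C.subscheme)
      {Zs : List (Closeds W)} (_hlen : Zs.length = n) (_hne : Zs ≠ []) (_hP : IsPiecePartition C Zs)
      (_hΓ : ∀ Z ∈ Zs, CentreIn D ℬ Z)
      {B₀ : Set W} (_hℬB : ∀ p ∈ ℬ, (p.1.support : Set W) ⊆ B₀) (_hCB : (C.support : Set W) ⊆ B₀)
      {W' : Scheme.{u}} {τ : W' ⟶ W} (_hτ : IsBlowup τ C),
      ∃ (_ : IsIntegral W') (_ : IsNoetherian W') (𝔟' D' : W'.IdealSheafData) (ℬ' 𝒟' : List (W'.IdealSheafData × ℕ)),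
        IsWeightedSeqJR 2 (τ ≫ ρ) 𝔟₀ 𝔟₀ [] [] 𝔟' D' ℬ' 𝒟' ∧ StateIn 𝔟' D' ℬ' 𝒟' ∧
        ((D'.support : Set W') = closure (τ ⁻¹' ((D.support : Set W) \ C.support))) ∧
        (∀ p ∈ ℬ', (p.1.support : Set W') ⊆ τ ⁻¹' B₀) := by
  induction n with
  | zero =>
    intro W _ _ ρ 𝔟 D ℬ 𝒟 S hseq C hC Zs hlen hne
    exact absurd (List.eq_nil_of_length_eq_zero hlen) hne
  | succ n ih =>
    intro W _ _ ρ 𝔟 D ℬ 𝒟 S hseq C hC Zs hlen hne hP hΓ B₀ hℬB hCB W' τ hτ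
    obtain ⟨Z, Zs', rfl⟩ : ∃ Z Zs', Zs = Z :: Zs' := by
      cases Zs with
      | nil => exact absurd rfl hne
      | cons Z Zs' => exact ⟨Z, Zs', rfl⟩
    have hlen' : Zs'.length = n := by simpa using hlen
    have hZC : (Z : Set W) ⊆ (C.support : Set W) := by
      rw [← hP.2]
      exact Set.subset_iUnion₂ (s := fun (Z' : Closeds W) (_ : Z' ∈ Z :: Zs') => (Z' : Set W)) Z List.mem_cons_self
    have hZB : (Z : Set W) ⊆ B₀ := hZC.trans hCB
    by_cases hnil : Zs' = []
    · -- ONE piece: `C = 𝓘(Z)`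
      subst hnil
      have hCZ : C = vanishingIdeal Z := by
        rw [← prod_pieceIdeals_eq_of_isRegular hC hP]; simp [pieceIdeals]
      subst hCZ
      obtain ⟨hint', hnoeth', m, e, e', hseq', S', -, hsupp, hbd⟩ :=
        pieces_loop_single S hseq (hΓ Z List.mem_cons_self) hℬB hZB hτ
      refine ⟨hint', hnoeth', _, _, _, _, hseq', S', ?_, hbd⟩
      rw [hsupp, Scheme.IdealSheafData.coe_support_vanishingIdeal]
    · -- SEVERAL pieces: peel the first
      obtain ⟨X₁, τ₁, τ₂, hcomp, hτ₁, -, -, -, -, hτ₂, hC₁, hP₁⟩ := hτ.exists_comp_eq_of_isPiecePartition_cons hC hP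
      obtain ⟨hint₁, hnoeth₁, m, e, e', hseq₁, S₁, hrad₁, hsupp₁, hbd₁⟩ :=
        pieces_loop_single S hseq (hΓ Z List.mem_cons_self) hℬB hZB hτ₁
      haveI := hint₁
      haveI := hnoeth₁
      -- the centre data of the lifted remaining pieces
      have hΓ₁ : ∀ Z₁ ∈ Zs'.map (fun W₀ : Closeds W => W₀.preimage τ₁.continuous),
          CentreIn (controlledTransform τ₁ (vanishingIdeal Z) D m) (stepExp ℬ τ₁ (vanishingIdeal Z) e) Z₁ := by
        intro Z₁ hZ₁
        obtain ⟨Z₂, hZ₂, rfl⟩ := List.mem_map.mp hZ₁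
        exact CentreIn.transport S (hΓ Z List.mem_cons_self) hτ₁ (hΓ Z₂ (List.mem_cons_of_mem _ hZ₂))
          (hP.disjoint_of_mem_tail hZ₂) e hrad₁
      have hne₁ : Zs'.map (fun W₀ : Closeds W => W₀.preimage τ₁.continuous) ≠ [] := by
        simpa using hnil
      have hlen₁ : (Zs'.map (fun W₀ : Closeds W => W₀.preimage τ₁.continuous)).length = n := by simpa using hlen'
      -- the support of the remaining centre lies over `⋃ Zs' ⊆ V(C) ⊆ B₀`
      set T : Set W := ⋃ Z₂ ∈ Zs', (Z₂ : Set W) with hT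
      have hC₁supp : (((pieceIdeals (Zs'.map fun W₀ : Closeds W => W₀.preimage τ₁.continuous)).prod).support : Set X₁) =
          τ₁ ⁻¹' T := by
        rw [← hP₁.2, hT]
        ext x
        simp only [List.mem_map, Set.mem_iUnion, exists_prop, Set.mem_preimage]
        constructor
        · rintro ⟨_, ⟨Z₂, hZ₂, rfl⟩, hx⟩
          exact ⟨Z₂, hZ₂, hx⟩
        · rintro ⟨Z₂, hZ₂, hx⟩
          exact ⟨_, ⟨Z₂, hZ₂, rfl⟩, hx⟩
      have hTC : T ⊆ (C.support : Set W) := by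
        rw [← hP.2, hT]
        exact Set.iUnion₂_subset fun Z₂ hZ₂ =>
          Set.subset_iUnion₂ (s := fun (Z' : Closeds W) (_ : Z' ∈ Z :: Zs') => (Z' : Set W)) Z₂ (List.mem_cons_of_mem _ hZ₂)
      have hZT : (Z : Set W) ∪ T = (C.support : Set W) := by
        rw [← hP.2, hT]
        ext x
        simp only [Set.mem_union, Set.mem_iUnion, List.mem_cons, exists_prop]
        constructor
        · rintro (hx | ⟨Z₂, hZ₂, hx⟩)
          · exact ⟨Z, Or.inl rfl, hx⟩
          · exact ⟨Z₂, Or.inr hZ₂, hx⟩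
        · rintro ⟨Z', rfl | hZ', hx⟩
          · exact Or.inl hx
          · exact Or.inr ⟨Z', hZ', hx⟩
      have hCB₁ : (((pieceIdeals (Zs'.map fun W₀ : Closeds W => W₀.preimage τ₁.continuous)).prod).support : Set X₁) ⊆
          τ₁ ⁻¹' B₀ := by
        rw [hC₁supp]; exact Set.preimage_mono (hTC.trans hCB)
      -- the induction hypothesis on the remaining pieces
      obtain ⟨hint', hnoeth', 𝔟', D', ℬ', 𝒟', hseq', S', hsupp', hbd'⟩ :=
        ih S₁ hseq₁ hC₁ hlen₁ hne₁ hP₁ hΓ₁ hbd₁ hCB₁ hτ₂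
      refine ⟨hint', hnoeth', 𝔟', D', ℬ', 𝒟', ?_, S', ?_, ?_⟩
      · rw [← hcomp, Category.assoc]; exact hseq'
      · -- supports: two-step strict transform = one-step ((L-G))
        rw [hsupp', hsupp₁, hC₁supp, hτ₂.closure_preimage_closure_preimage_diff τ₁ hC₁supp (D.support : Set W) (Z : Set W),
          hcomp, hZT]
      · intro p hp x' hx'
        have h1 := hbd' p hp hx'
        rw [← hcomp]
        simp only [Set.mem_preimage, Scheme.Hom.comp_base, TopCat.coe_comp, Function.comp_apply] at h1 ⊢
        exact h1

/-- [OURS · L1 W5.2 · T5-E] **THE PIECES LOOP** (res-D-pv-054's SPEC, verbatim): from a transport state `StateIn 𝔟 D ℬ 𝒟` at the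
end of a weighted sequence with boundary `IsWeightedSeqJR 2 ρ 𝔟₀ 𝔟₀ [] [] 𝔟 D ℬ 𝒟`, a regular centre `C` with a non-empty piece
partition `Zs` each piece carrying its `CentreIn` data, a boundary bound `B₀`, and ANY blowing up `τ` along `C`, the sequence
extends along `τ` (one `cons` per piece, maximal weights), to a transport state on `W'` whose host support is the strict
transform `cl τ⁻¹(Supp D ∖ V(C))` and whose boundary lies over `B₀`.
[cite: BierstoneGrigorievMilmanWlodarczyk2011, §4 Step 2b, Def. 3.1.3] [cite: CossartJannsenSaito2020, Thm. 1.4, (6.2)]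
[cite: StacksProject, Tag 080A] -/
theorem pieces_loop
    {E W : Scheme.{u}} [IsIntegral W] [IsNoetherian W] {ρ : W ⟶ E} {𝔟₀ : E.IdealSheafData}
    {𝔟 D : W.IdealSheafData} {ℬ 𝒟 : List (W.IdealSheafData × ℕ)} (S : StateIn 𝔟 D ℬ 𝒟)
    (hseq : DepthTargets.IsWeightedSeqJR 2 ρ 𝔟₀ 𝔟₀ [] [] 𝔟 D ℬ 𝒟)
    {C : W.IdealSheafData} (hC : Scheme.IsRegular C.subscheme)
    {Zs : List (Closeds W)} (hne : Zs ≠ []) (hP : IsPiecePartition C Zs) (hΓ : ∀ Z ∈ Zs, CentreIn D ℬ Z)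
    {B₀ : Set W} (hℬB : ∀ p ∈ ℬ, (p.1.support : Set W) ⊆ B₀) (hCB : (C.support : Set W) ⊆ B₀)
    {W' : Scheme.{u}} {τ : W' ⟶ W} (hτ : IsBlowup τ C) :
    ∃ (_ : IsIntegral W') (_ : IsNoetherian W') (𝔟' D' : W'.IdealSheafData) (ℬ' 𝒟' : List (W'.IdealSheafData × ℕ)),
      DepthTargets.IsWeightedSeqJR 2 (τ ≫ ρ) 𝔟₀ 𝔟₀ [] [] 𝔟' D' ℬ' 𝒟' ∧ StateIn 𝔟' D' ℬ' 𝒟' ∧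
      ((D'.support : Set W') = closure (τ ⁻¹' ((D.support : Set W) \ C.support))) ∧
      (∀ p ∈ ℬ', (p.1.support : Set W') ⊆ τ ⁻¹' B₀) :=
  pieces_loop_aux Zs.length S hseq hC rfl hne hP hΓ hℬB hCB hτ

end WeightTwoB

end Summit.ResolutionOfSingularities.ResolutionOfSingularities.Theorems

end
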